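import Literature.AlgebraicGeometry.Resolution.QuadraticTransformWeakTransform
import Summits.ResolutionOfSingularities.ResolutionOfSingularities.Theorems.ValuativeLuAlphaPTorsorColengthSharp
import HarnessLib

set_option linter.dupNamespace false

/-!
# Crux `FolLU` (stmt-ResolutionOfSingularities-17081), line `birth` — stub `stub_lengthWeakTransform`

Route `ResolutionOfSingularities/FoliationDescent`, the low-dimensional engine (valuative weak
Seidenberg theorem by a colength potential). **Giraud's Lemma 2.1.1 at one point of one chart,
unconditionally** (no hypothesis on the initial forms, unlike the tree's
`length_quotient_weakTransform_map_lt`, Huneke–Swanson 14.3.4).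

Setting: `(R, 𝔪 = (x, y))` a two-dimensional regular local subring of the field `K`,
`A = R[y/x] ⊆ K` the chart of the blowing up of the closed point (`chartAdjoin`, structure map
`ι = chartIncl x y`, `𝔪A = xA`), `J ⊆ 𝔪ʳ`, `J ⊄ 𝔪ʳ⁺¹` an ideal of finite colength,
`Jʷ = (JA : xʳ)` its weak transform (`weakTransformChart`), `Q` a prime of `A` and `L = A_Q`
(`LocalSubring.ofPrime`). PROVED:

* `stub_lengthWeakTransform` — **`L/JʷL` has finite length and
  `λ_L(L/JʷL) + λ_R(R/𝔪ʳ) ≤ λ_R(R/J)`** (for every `r`, including `r = 0`): the map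
  `𝔪ʳ → xʳA/JA ≅ A/Jʷ` is onto for every `J` of order exactly `r` and finite colength
  (Giraud 1983, Lemme 2.1.1; Kodiyalam 1995, Thm. 4.5 — `PfaffLine.exists_pow_mul_sub_mem_map`:
  division by the initial form of an `f ∈ J ∖ 𝔪ʳ⁺¹` in `A/xA ≅ κ[X]`, and `xᴺ ∈ J`) and kills
  `J`, so `λ_A(A/Jʷ) + λ_R(R/𝔪ʳ) ≤ λ_R(𝔪ʳ/J) + λ_R(R/𝔪ʳ) = λ_R(R/J)`
  (`PfaffLine.length_quotient_transform_add_length_le_of_forall_exists`, exactness of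
  `0 → 𝔪ʳ/J → R/J → R/𝔪ʳ → 0`); localisation does not increase length
  (`length_quotient_map_le_of_isLocalization`), and a module of length `< ⊤` has finite length.

References: J. Giraud, *Forme normale d'une fonction sur une surface de caractéristique
positive*, Bull. SMF 111 (1983), Lemme 2.1.1 [Giraud1983]; C. Huneke, I. Swanson, *Integral
Closure of Ideals, Rings, and Modules* (2006), Lemma 14.3.4 [HunekeSwanson2006].
-/

noncomputable section

namespace Summit.ResolutionOfSingularities.ResolutionOfSingularities.Theorems.FolLU

open Literature.AlgebraicGeometry.Resolution IsLocalRing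

/-- **Giraud's Lemma 2.1.1 at one point of one chart, unconditionally.** `R ⊆ K` a
two-dimensional regular local ring with regular system of parameters `(x, y)`, `J ⊆ 𝔪ʳ` an ideal
of finite colength with `J ⊄ 𝔪ʳ⁺¹` (order exactly `r`), `Q` any prime of the chart `A = R[y/x]`,
`Jʷ = (JA : xʳ)` the weak transform. Then `A_Q/JʷA_Q` has finite length and
`λ_{A_Q}(A_Q/JʷA_Q) + λ_R(R/𝔪ʳ) ≤ λ_R(R/J)`: the map `𝔪ʳ → xʳA/JA ≅ A/Jʷ` is onto
(`PfaffLine.exists_pow_mul_sub_mem_map`, division by the initial form of an `f ∈ J ∖ 𝔪ʳ⁺¹` in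
`A/xA ≅ κ[X]` and `xᴺ ∈ J`) and kills `J`, so `λ_A(A/Jʷ) ≤ λ_R(𝔪ʳ/J) = λ_R(R/J) − λ_R(R/𝔪ʳ)`
(`PfaffLine.length_quotient_transform_add_length_le_of_forall_exists`), and localisation does
not increase length (`length_quotient_map_le_of_isLocalization`). [cite: Giraud1983, Lemma 2.1.1] -/
theorem stub_lengthWeakTransform :
    ∀ (K : Type) [Field K] (R : Subring K) [IsRegularLocalRing R] (x y : R),
    ringKrullDim R = 2 → maximalIdeal R = Ideal.span {x, y} → x ≠ 0 →
    ∀ (J : Ideal R) (r : ℕ), J ≤ maximalIdeal R ^ r → ¬ J ≤ maximalIdeal R ^ (r + 1) →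
    IsFiniteLength R (R ⧸ J) →
    ∀ (Q : Ideal (chartAdjoin (K := K) x y)) [Q.IsPrime],
    IsFiniteLength (LocalSubring.ofPrime (chartAdjoin (K := K) x y) Q).toSubring
        ((LocalSubring.ofPrime (chartAdjoin (K := K) x y) Q).toSubring ⧸
          (weakTransformChart x y J r).map
            (algebraMap (chartAdjoin (K := K) x y)
              (LocalSubring.ofPrime (chartAdjoin (K := K) x y) Q).toSubring)) ∧
      Module.length (LocalSubring.ofPrime (chartAdjoin (K := K) x y) Q).toSubring
          ((LocalSubring.ofPrime (chartAdjoin (K := K) x y) Q).toSubring ⧸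
            (weakTransformChart x y J r).map
              (algebraMap (chartAdjoin (K := K) x y)
                (LocalSubring.ofPrime (chartAdjoin (K := K) x y) Q).toSubring)) +
        Module.length R (R ⧸ maximalIdeal R ^ r) ≤ Module.length R (R ⧸ J) := by
  intro K _ R _ x y hdim hm hx0 J r hJ hJr hfin Q _
  letI : Algebra R (chartAdjoin (K := K) x y) := (chartIncl x y).toAlgebra
  have hmS : (maximalIdeal R).map (algebraMap R (chartAdjoin (K := K) x y)) =
      Ideal.span {algebraMap R _ x} := map_maximalIdeal_chartIncl hm hx0
  -- Giraud: `𝔪ʳ → xʳA/JA` is onto, hence the bound on the chart ring `A`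
  have hA : Module.length (chartAdjoin (K := K) x y)
        (chartAdjoin (K := K) x y ⧸ weakTransformChart (K := K) x y J r) +
      Module.length R (R ⧸ maximalIdeal R ^ r) ≤ Module.length R (R ⧸ J) :=
    PfaffLine.length_quotient_transform_add_length_le_of_forall_exists
      (S := chartAdjoin (K := K) x y) hmS hJ
      (PfaffLine.exists_pow_mul_sub_mem_map hdim hm hx0 hJ hJr hfin)
  -- localisation does not increase length
  have hloc : Module.length (LocalSubring.ofPrime (chartAdjoin (K := K) x y) Q).toSubring
      ((LocalSubring.ofPrime (chartAdjoin (K := K) x y) Q).toSubring ⧸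
        (weakTransformChart x y J r).map
          (algebraMap (chartAdjoin (K := K) x y)
            (LocalSubring.ofPrime (chartAdjoin (K := K) x y) Q).toSubring)) ≤
      Module.length (chartAdjoin (K := K) x y)
        (chartAdjoin (K := K) x y ⧸ weakTransformChart (K := K) x y J r) :=
    length_quotient_map_le_of_isLocalization Q _
  have hle := (add_le_add hloc (le_refl (Module.length R (R ⧸ maximalIdeal R ^ r)))).trans hA
  refine ⟨?_, hle⟩
  -- a module of length `< ⊤` has finite length
  rw [← Module.length_ne_top_iff]
  exact ne_top_of_le_ne_top (Module.length_ne_top_iff.mpr hfin) (le_self_add.trans hle)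

end Summit.ResolutionOfSingularities.ResolutionOfSingularities.Theorems.FolLU

end
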